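import Summits.QuantumFields.BalabanUV.T4Continuum.Spine.NE5.TwoRunTorusNE5Scalars

/-!
# Spine/NE5/TwoRunTorusNE5Sizes — the SIZES of the END's constant packages (window `α_j`, configuration radius `R_j`,
# σ-distance `R_σ`) as explicit, exported formulas: T38 and T40 re-run with the sizes kept instead of hidden behind `∃ w`
# (cell `pub-balaban-gaps`, seat `ne5` gen 14; located point (x17))

WHY.  The minimal END of row NE5 (T39 `TwoRunTorusNE5Records`, read through T41∕T43∕T45) asks a producer, per scale `j`
and per (2.14)-term, for a walk record `TermWalkData (𝒦 j Z t φ) (w j)` — joint walk expansions of the term's kernels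
analytic on the configuration ball of radius `(w j).R`, bond locations at σ-distance `≥ (w j).Rσ` from the σ-region
([B9] Thm 3.10 (3.107)–(3.108) p. 416; [II] p. 13 «R_σ = ⅔M», p. 15).  The packages `w j` are EXPORTED BY AN `∃`: T43∕T45
tell the producer only `Admissible (α j) R_σ0` (so `α j < (w j).R`, `R_σ0 ≤ (w j).Rσ`), `1 < α j`, the window
`s∕θ^j ≤ α j` and the letters — LOWER bounds on the two sizes, no UPPER bound.  But the producer can meet `TermWalkData`
only up to ITS sizes: the two-run pencil record of T42 `TwoRunPencilDiagonal.termWalkData_pencil_diag` reaches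
configuration radius `R′ ≤ min(R, s₀∕r_j)` (`r_j` the two-run closeness, `s₀` the Neumann reach) and its σ-distance is the
geometric `⅔M`.  With `R_j`, `R_σ` hidden, NO producer can verify the END's hypothesis — located point (x17) of
`HOME/ne/NE5.md` §20, the size analogue of (x14)∕(x15)∕(x16).  The sizes ARE explicit inside the tree: T38
`TwoRunTorusNE5Windows.windows_of_thresholds` builds `α j = max 2 (s∕θ^j)`, `R_j = α j·(8(K+1)∕ϑ₀ + 2)`,
`R_σ = max R_σ0 (log(8(K+1)∕ϑ₀)∕ε)` (`K = max K̄_Γ K̄_E`) and even exports `R_j ≤ …`, but T40 `TwoRunTorusNE5Scalars.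
scalars_of_rates` discards the bound and nobody exports `R_σ`.

THIS FILE.  §1 `windows_sized` = T38 verbatim PLUS the three size EQUATIONS `α j = max 2 (s∕θ^j)`,
`(w j).R = max 2 (s∕θ^j)·(8(max K̄_Γ K̄_E + 1)∕ϑ + 2)`, `(w j).Rσ = max R_σ0 (log(8(max K̄_Γ K̄_E + 1)∕ϑ)∕ε)` (same witness,
`rfl`).  §2 `scalars_sized` = T40 RE-QUANTIFIED so that everything scale-free comes FIRST: from the letters
`K̄_Γ, K̄_E, K̄_C, ε, κ, m, ν`, the rate chain, `n_Λ, n_N` and the volume constant `a₅` alone there exist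
`ϑ, c_E, g, γ₂, a₂₀, w₀` AND TWO SIZE CONSTANTS `C_R > 2`, `C_σ` such that FOR ALL `θ, s, R_σ0` and every rate letter
`a ≥ 0` the packages exist with T40's per-scale clauses VERBATIM and the sizes `α j = max 2 (s∕θ^j)`,
`(w j).R = max 2 (s∕θ^j)·C_R`, `(w j).Rσ = max R_σ0 C_σ` (and `r_P` with `a ≤ γ₂ r_P²` last, since only it reads `a`).  Proof =
T40's, cut at its call of T38 (now §1) — `C_R = 8(K+1)∕ϑ₀ + 2`, `C_σ = log(8(K+1)∕ϑ₀)∕ε` with T40's own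
`ϑ₀ = 4(K+1)ϑ∕S`.  READING for the junction: the producer must afford `r_j·max 2 (s∕θ^j)·C_R ≤ s₀` at every scale — at late
scales the two-run RATE `r_j = O(θ^j)` of rows NE2∕NE3, at early scales (`θ^j ≥ s`) an absolute closeness `r_j ≤ s₀∕(2C_R)` —
and `⅔M ≥ max R_σ0 C_σ`, one more reason the bond-cube side must be the producer's (T45).  The END with the sizes exported
is `TwoRunTorusNE5Sized` (next file).

HONEST FRAMING.  Real-number bookkeeping over LANDED shapes (T38's witness, T40's proof re-cut); every letter explicit;
nothing of Bałaban's constructed or asserted (which sizes his operators afford is NODE O's (v)⁺ and rows NE2∕NE3's rate).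
NE5 NOT PRINTED ∕ NOT PROVED; leaves 0∕12; (D4) 0∕1; spine 0∕9.  Rung (B)+1 on a FIXED finite T⁴ — NOT continuum, NOT
infinite volume, NOT mass gap, NOT Clay.  HONEST DEPENDENCY: continuum YM on T⁴ ⇐ BetaPertH ∧ nine spine estimates;
BetaPertH ⇐ (D1) ∧ (D4) ∧ CAP+tail.  0 sorry, 0 `def`.

Sources: [II] = T. Bałaban, CMP **116** (1988) [Balaban1988RG2Cluster] (1.11) p. 5, p. 13, p. 15, (2.16) p. 16, (2.20)–(2.26)
pp. 16–17, p. 21; [B9] = CMP **99** (1985) [Balaban1985BackgroundPropagators] Thm 3.10, (3.107)–(3.108) p. 416; C. King,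
CMP **102** (1986) [King1986] p. 665.  Nothing here is a claim about the Yang–Mills mass gap.
-/

noncomputable section

namespace Summit.QuantumFields.BalabanUV.T4Continuum.Spine.NE5.TwoRunTorusNE5Sizes

open Literature.MathematicalPhysics.QuantumFieldTheory.Balaban1983to89
open Literature.MathematicalPhysics.QuantumFieldTheory.Balaban1983to89.B13TermWalkData (WalkConsts)
open Literature.MathematicalPhysics.QuantumFieldTheory.Balaban1983to89.B13TermWalkDataOneTorus (SmallTheta)
open Summit.QuantumFields.BalabanUV.T4Continuum.Spine.NE5.TwoRunTorusWalkNumerics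
  (numerics_of_thresholds smallRe_of_thresholds theta_group)
open Summit.QuantumFields.BalabanUV.T4Continuum.Spine.NE5.TwoRunTorusNE5Windows
  (two_mul_le_of_eighth exp_neg_le_of_log_le ratio_le_of_radius)
open Summit.QuantumFields.BalabanUV.T4Continuum.Spine.NE5.TwoRunTorusNE5Scalars (div_mul_le_self coeff_mono vol_of_small)

/-! ## §1. T38 with the package sizes exported -/

/-- **THE PER-SCALE PACKAGES WITH THEIR SIZES.**  T38 `TwoRunTorusNE5Windows.windows_of_thresholds` VERBATIM (same witness:
`α j = max 2 (s∕θ^j)`, `R_j = α j·(8(K+1)∕ϑ + 2)`, `R_σ = max R_σ0 (log(8(K+1)∕ϑ)∕ε)`, `K = max K̄_Γ K̄_E`) with three more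
conjuncts: the window, the configuration radius and the σ-distance of every package AS EQUATIONS — the sizes a producer
must afford, no longer hidden behind the `∃`. [cite: Balaban1988RG2Cluster, (1.11) p.5, p.13, p.15, (2.16) p.16, p.17; Balaban1985BackgroundPropagators, (3.108) p.416; King1986, p.665] -/
theorem windows_sized {KΓ KE KC ε κ ϑ : ℝ} (θ s Rσ₀ : ℝ) (hKΓ : 0 ≤ KΓ) (hKE : 0 ≤ KE) (hKC : 0 ≤ KC)
    (hε : 0 < ε) (hκ : 0 < κ) (hϑ : 0 < ϑ) :
    ∃ (w : ℕ → WalkConsts) (α : ℕ → ℝ),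
      (∀ j, (w j).Admissible (α j) Rσ₀) ∧ (∀ j, 1 < α j) ∧ (∀ j, θ ^ j < s → s / θ ^ j ≤ α j) ∧
      (∀ j, SmallTheta (w j) (α j) ϑ) ∧
      (∀ j, (w j).KbarΓ = KΓ ∧ (w j).KbarE = KE ∧ (w j).KbarC = KC ∧ (w j).kap = κ ∧ (w j).ε = ε) ∧
      (∀ j, α j = max 2 (s / θ ^ j)) ∧
      (∀ j, (w j).R = max 2 (s / θ ^ j) * (8 * (max KΓ KE + 1) / ϑ + 2)) ∧
      (∀ j, (w j).Rσ = max Rσ₀ (Real.log (8 * (max KΓ KE + 1) / ϑ) / ε)) ∧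
      (∀ j, Real.exp (-((w j).ε * (w j).Rσ)) + α j / (w j).R ≤ ϑ / (4 * (max KΓ KE + 1))) := by
  set K := max KΓ KE with hKdef
  have hK : 0 ≤ K := hKΓ.trans (le_max_left _ _)
  set Rσ := max Rσ₀ (Real.log (8 * (K + 1) / ϑ) / ε) with hRσdef
  let α : ℕ → ℝ := fun j => max 2 (s / θ ^ j)
  have hα2 : ∀ j, (2 : ℝ) ≤ α j := fun j => le_max_left _ _
  have hα0 : ∀ j, 0 < α j := fun j => two_pos.trans_le (hα2 j)
  let w : ℕ → WalkConsts := fun j =>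
    { R := α j * (8 * (K + 1) / ϑ + 2), ε := ε, kap := κ, KbarΓ := KΓ, KbarE := KE, KbarC := KC, Rσ := Rσ }
  have hexp : Real.exp (-(ε * Rσ)) ≤ ϑ / (8 * (K + 1)) :=
    exp_neg_le_of_log_le hK hε hϑ (le_max_right _ _)
  have hexp0 : 0 ≤ Real.exp (-(ε * Rσ)) := (Real.exp_pos _).le
  refine ⟨w, α, fun j => ?_, fun j => one_lt_two.trans_le (hα2 j), fun j _ => le_max_right _ _, fun j => ?_,
    fun j => ⟨rfl, rfl, rfl, rfl, rfl⟩, fun j => rfl, fun j => rfl, fun j => rfl, fun j => ?_⟩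
  · -- admissibility at size `α j` and floor `Rσ₀`
    exact { hαR := (ratio_le_of_radius hK hϑ (hα0 j)).2, hε := hε.le, hkap := hκ, hKbarΓ := hKΓ, hKbarE := hKE,
            hKbarC := hKC, hRσ := le_max_left _ _ }
  · -- NODE A's smallness with the common `ϑ`
    have hrat := (ratio_le_of_radius hK hϑ (hα0 j)).1
    have hrat0 : 0 ≤ α j / (α j * (8 * (K + 1) / ϑ + 2)) :=
      div_nonneg (hα0 j).le ((hα0 j).trans (ratio_le_of_radius hK hϑ (hα0 j)).2).le
    exact { hΓ := two_mul_le_of_eighth hK (le_max_left _ _) hϑ.le hexp0 hrat0 hexp hrat,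
            hE := two_mul_le_of_eighth hK (le_max_right _ _) hϑ.le hexp0 hrat0 hexp hrat }
  · -- the decay ∕ reach number of the package is uniformly small in the scale
    have hrat := (ratio_le_of_radius hK hϑ (hα0 j)).1
    have hK1 : 0 < 8 * (K + 1) := by positivity
    calc Real.exp (-(ε * Rσ)) + α j / (α j * (8 * (K + 1) / ϑ + 2))
        ≤ ϑ / (8 * (K + 1)) + ϑ / (8 * (K + 1)) := add_le_add hexp hrat
      _ = ϑ / (4 * (K + 1)) := by field_simp; ring

/-! ## §2. T40 re-quantified: scale-free letters and the two size constants first, then the packages -/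

/-- **THE NON-LEMMA-3 SCALAR BINDERS OF T39, SCALE-FREE PART FIRST, WITH THE PACKAGE SIZES EXPORTED.**  From the letters
`K̄_Γ, K̄_E, K̄_C ≥ 0`, `ε, κ > 0`, the fibre bound `m ≥ 0`, `ν`, a rate chain `κ > κ_a > κ_b > κ′ > κ″ > 0`, the size ratios
`n_Λ, n_N ≥ 0` and the volume constant `a₅ > 0` ALONE: letters `ϑ > 0, c_E, g ≥ 0, γ₂ > 0, a₂₀ ≥ 0, w₀ > 0` with T39's
scale-free clauses `hαc`, `hsmall`, and SIZE CONSTANTS `C_R > 2`, `C_σ`, such that for ALL rates `θ`, margins `s`, floors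
`R_σ0` and rate letters `a ≥ 0` there are packages `w j`, sizes `α j` and `r_P` with T40's per-scale clauses VERBATIM
(`hw hα1 hαs hsm hκa`, letters, `hθR1le` for every `0 ≤ m_𝒦 ≤ m`, `hsmallKθ`, `hcE hgE hsmallRe`, `hPa`, `hvol`) AND
`α j = max 2 (s∕θ^j)`, `(w j).R = max 2 (s∕θ^j)·C_R`, `(w j).Rσ = max R_σ0 C_σ`.  (Witness = T40's: `C_R = 8(K+1)∕ϑ₀ + 2`,
`C_σ = log(8(K+1)∕ϑ₀)∕ε`, `ϑ₀ = 4(K+1)ϑ∕(2K̄_Γ + 2K̄_E + Q(m) + 1)`, `K = max K̄_Γ K̄_E`; proof = T40's, cut at §1.)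
[cite: Balaban1988RG2Cluster, p.7, p.13, p.15, (2.16) p.16, (2.20)–(2.26) pp.16–17, p.20, p.21; Balaban1985BackgroundPropagators, (3.108) p.416; King1986, p.665] -/
theorem scalars_sized {KΓ KE KC ε κ : ℝ} (hKΓ : 0 ≤ KΓ) (hKE : 0 ≤ KE) (hKC : 0 ≤ KC)
    (hε : 0 < ε) (hκ : 0 < κ) {m : ℝ} (hm : 0 ≤ m) (ν : ℕ)
    {κa κb kap' kap'' : ℝ} (hκa : κa < κ) (hκb : κb < κa) (h2 : kap' < κb) (h1 : kap'' < kap')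
    (hkap'' : 0 < kap'') {nΛ nN : ℝ} (hnΛ : 0 ≤ nΛ) (hnN : 0 ≤ nN) {a₅ : ℝ} (ha₅ : 0 < a₅) :
    ∃ (ϑ cE g γ₂ a₂₀ w₀ CR Cσ : ℝ),
      0 < ϑ ∧ 0 ≤ cE ∧ 0 ≤ g ∧ 0 < γ₂ ∧ 0 ≤ a₂₀ ∧ 0 < w₀ ∧ 2 < CR ∧
      -- the (2.20)∕(2.22) constants' clauses `hαc`, `hsmall` (scale-free)
      (2 * (ϑ * (m * (1 + 2 / kap'') ^ ν)) + (γ₂ + a₂₀)) * cE ≤ 1 / 2 ∧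
      (2 * (ϑ * (m * (1 + 2 / kap'') ^ ν)) + (γ₂ + a₂₀)) * (1 + 2 * cE * g) ≤ 1 / 2 ∧
      ∀ (θ s Rσ₀ a : ℝ), 0 ≤ a → ∃ (w : ℕ → WalkConsts) (α : ℕ → ℝ) (rP : ℝ),
      -- (W) the windows (T38)
      (∀ j, (w j).Admissible (α j) Rσ₀) ∧ (∀ j, 1 < α j) ∧ (∀ j, θ ^ j < s → s / θ ^ j ≤ α j) ∧
      (∀ j, SmallTheta (w j) (α j) ϑ) ∧ (∀ j, κa < (w j).kap) ∧
      (∀ j, (w j).KbarΓ = KΓ ∧ (w j).KbarE = KE ∧ (w j).KbarC = KC ∧ (w j).kap = κ ∧ (w j).ε = ε) ∧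
      -- the SIZES of the packages: window, configuration radius, σ-distance
      (∀ j, α j = max 2 (s / θ ^ j)) ∧ (∀ j, (w j).R = max 2 (s / θ ^ j) * CR) ∧ (∀ j, (w j).Rσ = max Rσ₀ Cσ) ∧
      -- (P) `hθR1le`, for every record fibre number `m_𝒦 ≤ m`
      (∀ j, ∀ mK : ℝ, 0 ≤ mK → mK ≤ m →
        (m * (1 + 2 / (κb - kap')) ^ ν) * (m * (1 + 2 / (kap' - kap'')) ^ ν)
          * ((2 * (w j).KbarΓ * Real.exp (-((w j).ε * (w j).Rσ)) + 2 * (w j).KbarΓ * α j / (w j).R) * (w j).KbarC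
              * (w j).KbarΓ
            + (w j).KbarΓ * ((w j).KbarC * (2 * (w j).KbarE * Real.exp (-((w j).ε * (w j).Rσ))
                + 2 * (w j).KbarE * α j / (w j).R)
                * (mK * (1 + 2 / ((w j).kap - κa)) ^ ν) * (w j).KbarC
                * (mK * (1 + 2 / (κa - κb)) ^ ν)) * (w j).KbarΓ
            + (w j).KbarΓ * (w j).KbarC * (2 * (w j).KbarΓ * Real.exp (-((w j).ε * (w j).Rσ))
                + 2 * (w j).KbarΓ * α j / (w j).R)) ≤ ϑ) ∧
      -- `hsmallKθ`
      (∀ j, (w j).KbarC * (m * (1 + 2 / κb) ^ ν) * (ϑ * (m * (1 + 2 / kap'') ^ ν)) < 1) ∧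
      -- the envelopes `hcE`, `hgE` and NODE A's positivity smallness `hsmallRe`
      (∀ j, (w j).KbarC * (m * (1 + 2 / (w j).kap) ^ ν) ≤ cE) ∧
      (∀ j, cE * ((w j).KbarΓ * (m * (1 + 2 / (w j).kap) ^ ν)) ^ 2 ≤ g) ∧
      (∀ j, (2 * (w j).KbarE * Real.exp (-((w j).ε * (w j).Rσ)) + 2 * (w j).KbarE * α j / (w j).R)
        * (m * (1 + 2 / (w j).kap) ^ ν) * cE < 1) ∧
      -- `hPa`
      a ≤ γ₂ * rP ^ 2 ∧
      -- `hvol` for every term with `|Λ| ≤ n_Λ|Z|`, `|Λ ⊕ C₀| ≤ n_N|Z|`, and every (2.20)-constant `w₂₀ ≤ w₀|Z|`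
      (∀ j, ∀ cΛ cN nZ w₂₀ : ℝ, 0 ≤ nZ → 0 ≤ cΛ → 0 ≤ cN → cΛ ≤ nΛ * nZ → cN ≤ nN * nZ → w₂₀ ≤ w₀ * nZ →
        2 * ((w j).KbarC * (m * (1 + 2 / κb) ^ ν) * (ϑ * (m * (1 + 2 / kap'') ^ ν))
              * (1 + (1 - (w j).KbarC * (m * (1 + 2 / κb) ^ ν) * (ϑ * (m * (1 + 2 / kap'') ^ ν)))⁻¹) / 2)
            * cΛ
          + w₂₀ + (2 * (ϑ * (m * (1 + 2 / kap'') ^ ν)) + (γ₂ + a₂₀)) * cE * cΛ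
          + (2 * (ϑ * (m * (1 + 2 / kap'') ^ ν)) + (γ₂ + a₂₀)) * (1 + 2 * cE * g) * cN ≤ a₅ * nZ) := by
  have hgb : 0 < κb - kap' := sub_pos.2 h2
  have hg1 : 0 < kap' - kap'' := sub_pos.2 h1
  have hga : 0 < κ - κa := sub_pos.2 hκa
  have hgab : 0 < κa - κb := sub_pos.2 hκb
  have hκb0 : 0 < κb := hkap''.trans (h1.trans h2)
  have hP₀ : 0 ≤ m * (1 + 2 / κ) ^ ν := by positivity
  have hP₄ : 0 ≤ m * (1 + 2 / κb) ^ ν := by positivity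
  have hP₅ : 0 ≤ m * (1 + 2 / kap'') ^ ν := by positivity
  have hP1a : 0 ≤ m * (1 + 2 / (κb - kap')) ^ ν := by positivity
  have hP1b : 0 ≤ m * (1 + 2 / (kap' - kap'')) ^ ν := by positivity
  have hc₂ : 0 ≤ 1 + 2 / (κ - κa) := by positivity
  have hc₃ : 0 ≤ 1 + 2 / (κa - κb) := by positivity
  -- the envelopes, the small unit `t = min 1 a₅` and the (2.20)∕(2.22) threshold `G = t∕D`
  set cE : ℝ := KC * (m * (1 + 2 / κ) ^ ν) with hcEdef
  clear_value cE
  have hcE : 0 ≤ cE := by rw [hcEdef]; exact mul_nonneg hKC hP₀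
  set g : ℝ := cE * (KΓ * (m * (1 + 2 / κ) ^ ν)) ^ 2 with hgdef
  clear_value g
  have hg : 0 ≤ g := by rw [hgdef]; positivity
  set t : ℝ := min 1 a₅ with htdef
  have ht0 : 0 < t := by rw [htdef]; exact lt_min one_pos ha₅
  have ht1 : t ≤ 1 := by rw [htdef]; exact min_le_left _ _
  have hta : t ≤ a₅ := by rw [htdef]; exact min_le_right _ _
  clear_value t
  set D : ℝ := 8 * (cE + 1) * (2 + 2 * cE * g) * (nΛ + nN + 1) with hDdef
  clear_value D
  have hcg : 0 ≤ cE * g := mul_nonneg hcE hg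
  have hK1 : (1 : ℝ) ≤ nΛ + nN + 1 := by linarith only [hnΛ, hnN]
  have hE1 : 2 * (cE + 1) ≤ (cE + 1) * (2 + 2 * cE * g) := by
    have h0 : 0 ≤ (cE + 1) * (2 * cE * g) := mul_nonneg (by linarith only [hcE]) (by linarith only [hcg])
    have e : (cE + 1) * (2 + 2 * cE * g) = 2 * (cE + 1) + (cE + 1) * (2 * cE * g) := by ring
    rw [e]; linarith only [h0]
  have hE2 : 2 + 2 * cE * g ≤ (cE + 1) * (2 + 2 * cE * g) := by
    have h0 : 0 ≤ cE * (2 + 2 * cE * g) := mul_nonneg hcE (by linarith only [hcg])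
    have e : (cE + 1) * (2 + 2 * cE * g) = (2 + 2 * cE * g) + cE * (2 + 2 * cE * g) := by ring
    rw [e]; linarith only [h0]
  have hPi0 : 0 ≤ (cE + 1) * (2 + 2 * cE * g) := by positivity
  have hPi1 := hE1.trans (le_mul_of_one_le_right hPi0 hK1)
  have hPi2 := hE2.trans (le_mul_of_one_le_right hPi0 hK1)
  have hPi3 : 2 * (nΛ + nN + 1) ≤ (cE + 1) * (2 + 2 * cE * g) * (nΛ + nN + 1) :=
    mul_le_mul_of_nonneg_right (by linarith only [hE1, hcE]) (by linarith only [hnΛ, hnN])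
  have hDeq : D = 8 * ((cE + 1) * (2 + 2 * cE * g) * (nΛ + nN + 1)) := by rw [hDdef]; ring
  have hDK : 16 * (nΛ + nN + 1) ≤ D := by rw [hDeq]; linarith only [hPi3]
  have hD : 0 < D := by linarith only [hDK, hK1]
  set G : ℝ := t / D with hGdef
  clear_value G
  have hG0 : 0 < G := by rw [hGdef]; exact div_pos ht0 hD
  have hG16 : G * (16 * (nΛ + nN + 1)) ≤ t := by rw [hGdef]; exact div_mul_le_self ht0.le hD hDK
  have hGD : G * D = t := by rw [hGdef]; exact div_mul_cancel₀ t hD.ne'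
  have hGc : 4 * G * cE ≤ 1 := by
    have h := div_mul_le_self ht0.le hD (by rw [hDeq]; linarith only [hPi1, hcE] : 4 * cE ≤ D)
    have e : 4 * G * cE = t / D * (4 * cE) := by rw [hGdef]; ring
    linarith only [h, e, ht1]
  have hGc' : G * cE ≤ 1 / 4 := by
    have e : 4 * G * cE = 4 * (G * cE) := by ring
    linarith only [hGc, e]
  have hGg : 4 * G * (1 + 2 * cE * g) ≤ 1 := by
    have h := div_mul_le_self ht0.le hD (by rw [hDeq]; linarith only [hPi2, hcg] : 4 * (1 + 2 * cE * g) ≤ D)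
    have e : 4 * G * (1 + 2 * cE * g) = t / D * (4 * (1 + 2 * cE * g)) := by rw [hGdef]; ring
    linarith only [h, e, ht1]
  clear hE1 hE2 hPi0 hPi1 hPi2 hPi3
  -- NODE A's smallness `ϑ = G∕Dϑ`, `Dϑ = 4·(P₅+1)·(K̄_C P₄+1)·(P₀+1)`
  set Dϑ : ℝ := 4 * ((m * (1 + 2 / kap'') ^ ν) + 1) * (KC * (m * (1 + 2 / κb) ^ ν) + 1)
    * ((m * (1 + 2 / κ) ^ ν) + 1) with hDϑdef
  clear_value Dϑ
  have hKP4 : 0 ≤ KC * (m * (1 + 2 / κb) ^ ν) := mul_nonneg hKC hP₄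
  have hKP45 : 0 ≤ KC * (m * (1 + 2 / κb) ^ ν) * (m * (1 + 2 / kap'') ^ ν) := mul_nonneg hKP4 hP₅
  have hY1 : (1 : ℝ) ≤ KC * (m * (1 + 2 / κb) ^ ν) + 1 := by linarith only [hKP4]
  have hXY1 : (1 : ℝ) ≤ ((m * (1 + 2 / kap'') ^ ν) + 1) * (KC * (m * (1 + 2 / κb) ^ ν) + 1) :=
    one_le_mul_of_one_le_of_one_le (by linarith only [hP₅]) hY1
  have hXYZ : ((m * (1 + 2 / kap'') ^ ν) + 1) * (KC * (m * (1 + 2 / κb) ^ ν) + 1) ≤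
      ((m * (1 + 2 / kap'') ^ ν) + 1) * (KC * (m * (1 + 2 / κb) ^ ν) + 1) * ((m * (1 + 2 / κ) ^ ν) + 1) :=
    le_mul_of_one_le_right (zero_le_one.trans hXY1) (by linarith only [hP₀])
  have hXle : (m * (1 + 2 / kap'') ^ ν) + 1 ≤
      ((m * (1 + 2 / kap'') ^ ν) + 1) * (KC * (m * (1 + 2 / κb) ^ ν) + 1) * ((m * (1 + 2 / κ) ^ ν) + 1) :=
    (le_mul_of_one_le_right (by linarith only [hP₅]) hY1).trans hXYZ
  have hZle : (m * (1 + 2 / κ) ^ ν) + 1 ≤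
      ((m * (1 + 2 / kap'') ^ ν) + 1) * (KC * (m * (1 + 2 / κb) ^ ν) + 1) * ((m * (1 + 2 / κ) ^ ν) + 1) :=
    le_mul_of_one_le_left (by linarith only [hP₀]) hXY1
  have hb : KC * (m * (1 + 2 / κb) ^ ν) * (m * (1 + 2 / kap'') ^ ν) + 1 ≤
      ((m * (1 + 2 / kap'') ^ ν) + 1) * (KC * (m * (1 + 2 / κb) ^ ν) + 1) := by
    have e : ((m * (1 + 2 / kap'') ^ ν) + 1) * (KC * (m * (1 + 2 / κb) ^ ν) + 1) =
        KC * (m * (1 + 2 / κb) ^ ν) * (m * (1 + 2 / kap'') ^ ν) + 1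
          + ((m * (1 + 2 / kap'') ^ ν) + KC * (m * (1 + 2 / κb) ^ ν)) := by ring
    rw [e]; linarith only [hKP4, hP₅]
  have hDϑeq : Dϑ = 4 * (((m * (1 + 2 / kap'') ^ ν) + 1) * (KC * (m * (1 + 2 / κb) ^ ν) + 1)
      * ((m * (1 + 2 / κ) ^ ν) + 1)) := by rw [hDϑdef]; ring
  have hDϑ : 0 < Dϑ := by rw [hDϑeq]; linarith only [hXY1, hXYZ]
  set ϑ : ℝ := G / Dϑ with hϑdef
  clear_value ϑ
  have hϑ0 : 0 < ϑ := by rw [hϑdef]; exact div_pos hG0 hDϑ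
  -- the θ-thresholds of T34, `ϑP₀ ≤ G∕4` (for `hsmallRe`) and `A = K̄_C P₄ ϑ P₅ ≤ G∕4` (for `hvol`)
  have hθG : 2 * ϑ * (m * (1 + 2 / kap'') ^ ν) ≤ G := by
    have h' := div_mul_le_self hG0.le hDϑ (by rw [hDϑeq]; linarith only [hXle, hP₅] :
      2 * (m * (1 + 2 / kap'') ^ ν) ≤ Dϑ)
    have e : 2 * ϑ * (m * (1 + 2 / kap'') ^ ν) = G / Dϑ * (2 * (m * (1 + 2 / kap'') ^ ν)) := by rw [hϑdef]; ring
    linarith only [h', e]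
  have hθK : 2 * ϑ * (KC * (m * (1 + 2 / κb) ^ ν) * (m * (1 + 2 / kap'') ^ ν) + 1) ≤ 1 := by
    have h' := div_mul_le_self hG0.le hDϑ (by rw [hDϑeq]; linarith only [hb, hXYZ, hKP45] :
      2 * (KC * (m * (1 + 2 / κb) ^ ν) * (m * (1 + 2 / kap'') ^ ν) + 1) ≤ Dϑ)
    have e : 2 * ϑ * (KC * (m * (1 + 2 / κb) ^ ν) * (m * (1 + 2 / kap'') ^ ν) + 1) =
        G / Dϑ * (2 * (KC * (m * (1 + 2 / κb) ^ ν) * (m * (1 + 2 / kap'') ^ ν) + 1)) := by rw [hϑdef]; ring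
    have hG1 : G ≤ 1 := by
      have h16 : G * 16 ≤ G * (16 * (nΛ + nN + 1)) := mul_le_mul_of_nonneg_left (by linarith only [hK1]) hG0.le
      linarith only [h16, hG16, ht1]
    linarith only [h', e, hG1]
  have hϑP₀ : ϑ * (m * (1 + 2 / κ) ^ ν) ≤ G / 4 := by
    have h' := div_mul_le_self hG0.le hDϑ (by rw [hDϑeq]; linarith only [hZle] : 4 * (m * (1 + 2 / κ) ^ ν) ≤ Dϑ)
    have e : 4 * (ϑ * (m * (1 + 2 / κ) ^ ν)) = G / Dϑ * (4 * (m * (1 + 2 / κ) ^ ν)) := by rw [hϑdef]; ring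
    linarith only [h', e]
  have hAG : KC * (m * (1 + 2 / κb) ^ ν) * (ϑ * (m * (1 + 2 / kap'') ^ ν)) ≤ G / 4 := by
    have h' := div_mul_le_self hG0.le hDϑ (by rw [hDϑeq]; linarith only [hb, hXYZ] :
      4 * (KC * (m * (1 + 2 / κb) ^ ν) * (m * (1 + 2 / kap'') ^ ν)) ≤ Dϑ)
    have e : 4 * (KC * (m * (1 + 2 / κb) ^ ν) * (ϑ * (m * (1 + 2 / kap'') ^ ν))) =
        G / Dϑ * (4 * (KC * (m * (1 + 2 / κb) ^ ν) * (m * (1 + 2 / kap'') ^ ν))) := by rw [hϑdef]; ring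
    linarith only [h', e]
  have hA0 : 0 ≤ KC * (m * (1 + 2 / κb) ^ ν) * (ϑ * (m * (1 + 2 / kap'') ^ ν)) := by positivity
  clear hY1 hXY1 hXYZ hXle hZle hb hDϑeq
  have hGsum : G / 2 + G / 2 ≤ G := (add_halves G).le
  have hθgrp := theta_group (KC := KC) (P4 := m * (1 + 2 / κb) ^ ν) (P5 := m * (1 + 2 / kap'') ^ ν) (θ := ϑ)
    (G := G) (γ₂ := G / 2) (a₂₀ := G / 2) (cE := cE) (g := g) hKC hP₄ hP₅ hϑ0.le hcE hg (half_pos hG0).le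
    (half_pos hG0).le hGsum hGc hGg hθG hθK
  -- the `hθR1le` coefficient at `m_𝒦 = m` and the decay ∕ reach budget `ϑ∕S` handed to T38 as `ϑ₀`
  set Qm : ℝ := (m * (1 + 2 / (κb - kap')) ^ ν) * (m * (1 + 2 / (kap' - kap'')) ^ ν) *
      (2 * KΓ * KC * KΓ + KΓ * (KC * (2 * KE) * (m * (1 + 2 / (κ - κa)) ^ ν) * KC
        * (m * (1 + 2 / (κa - κb)) ^ ν)) * KΓ + KΓ * KC * (2 * KΓ)) with hQmdef
  clear_value Qm
  have hQm : 0 ≤ Qm := by rw [hQmdef]; positivity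
  set S : ℝ := 2 * KΓ + 2 * KE + Qm + 1 with hSdef
  clear_value S
  have hS : 0 < S := by rw [hSdef]; positivity
  have hK1' : 0 < max KΓ KE + 1 := by
    have h0 : 0 ≤ max KΓ KE := hKΓ.trans (le_max_left _ _)
    linarith only [h0]
  have hϑ₀ : 0 < 4 * (max KΓ KE + 1) * (ϑ / S) := by positivity
  refine ⟨ϑ, cE, g, G / 2, G / 2, t / 16, 8 * (max KΓ KE + 1) / (4 * (max KΓ KE + 1) * (ϑ / S)) + 2,
    Real.log (8 * (max KΓ KE + 1) / (4 * (max KΓ KE + 1) * (ϑ / S))) / ε, hϑ0, hcE, hg, half_pos hG0,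
    (half_pos hG0).le, by positivity, ?_, hθgrp.2.1, hθgrp.2.2.1, ?_⟩
  · -- `2 < C_R`
    have hq : 0 < 8 * (max KΓ KE + 1) / (4 * (max KΓ KE + 1) * (ϑ / S)) := by positivity
    linarith only [hq]
  intro θ s Rσ₀ a ha
  obtain ⟨w, α, hw, hα1, hαs, -, hlett, hαeq, hReq, hRσeq, hd⟩ := windows_sized θ s Rσ₀ hKΓ hKE hKC hε hκ hϑ₀
  have hdS : ∀ j, Real.exp (-((w j).ε * (w j).Rσ)) + α j / (w j).R ≤ ϑ / S := fun j =>
    (hd j).trans_eq (mul_div_cancel_left₀ (ϑ / S) (mul_pos four_pos hK1').ne')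
  have hRj : ∀ j, 0 < (w j).R := fun j => (zero_lt_one.trans (hα1 j)).trans (hw j).hαR
  have hαj : ∀ j, 0 ≤ α j := fun j => (zero_lt_one.trans (hα1 j)).le
  have hKΓw : ∀ j, 0 ≤ (w j).KbarΓ := fun j => (hlett j).1.symm ▸ hKΓ
  have hKEw : ∀ j, 0 ≤ (w j).KbarE := fun j => (hlett j).2.1.symm ▸ hKE
  have hKCw : ∀ j, 0 ≤ (w j).KbarC := fun j => (hlett j).2.2.1.symm ▸ hKC
  have hκaw : ∀ j, κa < (w j).kap := fun j => (hlett j).2.2.2.1.symm ▸ hκa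
  have hθKw : ∀ j, 2 * ϑ * ((w j).KbarC * (m * (1 + 2 / κb) ^ ν) * (m * (1 + 2 / kap'') ^ ν) + 1) ≤ 1 :=
    fun j => by rw [(hlett j).2.2.1]; exact hθK
  -- T34's threshold (3) per scale and record fibre number, from T38's decay ∕ reach bound and `coeff_mono`
  have hs : ∀ j (mK : ℝ), 0 ≤ mK → mK ≤ m → (Real.exp (-((w j).ε * (w j).Rσ)) + α j / (w j).R) *
      (2 * (w j).KbarΓ + 2 * (w j).KbarE +
        (m * (1 + 2 / (κb - kap')) ^ ν) * (m * (1 + 2 / (kap' - kap'')) ^ ν) *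
          (2 * (w j).KbarΓ * (w j).KbarC * (w j).KbarΓ
            + (w j).KbarΓ * ((w j).KbarC * (2 * (w j).KbarE) * (mK * (1 + 2 / ((w j).kap - κa)) ^ ν)
                * (w j).KbarC * (mK * (1 + 2 / (κa - κb)) ^ ν)) * (w j).KbarΓ
            + (w j).KbarΓ * (w j).KbarC * (2 * (w j).KbarΓ))) ≤ ϑ := by
    intro j mK hmK hmKm
    obtain ⟨hKΓj, hKEj, hKCj, hkapj, -⟩ := hlett j
    have hd0 : 0 ≤ Real.exp (-((w j).ε * (w j).Rσ)) + α j / (w j).R := by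
      have := hRj j; have := hαj j; positivity
    rw [hKΓj, hKEj, hKCj, hkapj]
    have hmono := coeff_mono (ν := ν) hKΓ hKE hKC hP1a hP1b hc₂ hc₃ hmK hmKm
    have hle : 2 * KΓ + 2 * KE +
        (m * (1 + 2 / (κb - kap')) ^ ν) * (m * (1 + 2 / (kap' - kap'')) ^ ν) *
          (2 * KΓ * KC * KΓ + KΓ * (KC * (2 * KE) * (mK * (1 + 2 / (κ - κa)) ^ ν) * KC
            * (mK * (1 + 2 / (κa - κb)) ^ ν)) * KΓ + KΓ * KC * (2 * KΓ)) ≤ S := by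
      rw [hSdef, hQmdef]; linarith only [hmono]
    calc _ ≤ (Real.exp (-((w j).ε * (w j).Rσ)) + α j / (w j).R) * S := mul_le_mul_of_nonneg_left hle hd0
      _ ≤ ϑ / S * S := mul_le_mul_of_nonneg_right (hdS j) hS.le
      _ = ϑ := div_mul_cancel₀ ϑ hS.ne'
  -- T34 per scale and record fibre number (its volume slot fed trivially; `hvol` comes from `vol_of_small` instead)
  have key := fun (j : ℕ) (mK : ℝ) (hmK : 0 ≤ mK) (hmKm : mK ≤ m) =>
    numerics_of_thresholds (w j) (hKΓw j) (hKEw j) (hKCw j) (hαj j) (hRj j) hm hmK (ν := ν) (hκaw j) hκb h2 h1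
      hkap'' (θ := ϑ) (G := G) (γ₂ := G / 2) (a₂₀ := G / 2) (w₂₀ := 0) (cE := cE) (g := g) (a₅ := 0) (nΛ := 0)
      (nN := 0) (w₀ := 0) (nZ := 0) (cΛ := 0) (cN := 0) hcE hg (half_pos hG0).le (half_pos hG0).le hϑ0.le le_rfl
      hGsum hGc hGg hθG (hθKw j) (hs j mK hmK hmKm) (by simp) (by simp) le_rfl le_rfl (by simp) (by norm_num)
  refine ⟨w, α, a / (G / 2) + 1, hw, hα1, hαs, fun j => (key j 0 le_rfl hm).1, hκaw, hlett, hαeq, hReq, hRσeq,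
    fun j mK hmK hmKm => (key j mK hmK hmKm).2.1, fun j => (key j 0 le_rfl hm).2.2.1,
    fun j => ?_, fun j => ?_, fun j => ?_, ?_, fun j cΛ cN nZ w₂₀ hnZ hcΛ0 hcN0 hcΛ hcN hw₂₀ => ?_⟩
  · -- hcE
    rw [(hlett j).2.2.1, (hlett j).2.2.2.1, hcEdef]
  · -- hgE
    rw [(hlett j).1, (hlett j).2.2.2.1, hgdef]
  · -- hsmallRe (T34's `smallRe_of_thresholds`, NODE A's letter from `SmallTheta`, and `2ϑ(P₀c_E) ≤ 1`)
    obtain ⟨-, hKEj, -, hkapj, -⟩ := hlett j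
    have hθRe : 2 * ϑ * ((m * (1 + 2 / (w j).kap) ^ ν) * cE) ≤ 1 := by
      rw [hkapj]
      have f := mul_le_mul_of_nonneg_right hϑP₀ hcE
      have e1 : 2 * ϑ * ((m * (1 + 2 / κ) ^ ν) * cE) = 2 * (ϑ * (m * (1 + 2 / κ) ^ ν) * cE) := by ring
      have e2 : G / 4 * cE = 1 / 4 * (G * cE) := by ring
      linarith only [f, e1, e2, hGc']
    exact smallRe_of_thresholds (w j) (hKEj.symm ▸ hKE) (hαj j) (hRj j) hm (hkapj.symm ▸ hκ) hcE
      (key j 0 le_rfl hm).1.hE hθRe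
  · -- hPa : a ≤ γ₂ r_P² with r_P = a∕γ₂ + 1 ≥ 1
    have hγ : 0 < G / 2 := half_pos hG0
    have hr1 : 1 ≤ a / (G / 2) + 1 := by
      have h0 : 0 ≤ a / (G / 2) := div_nonneg ha hγ.le
      linarith only [h0]
    have hGne : G ≠ 0 := hG0.ne'
    have e : G / 2 * (a / (G / 2) + 1) = a + G / 2 := by field_simp
    calc a ≤ a + G / 2 := by linarith only [hG0]
      _ = G / 2 * (a / (G / 2) + 1) := e.symm
      _ ≤ G / 2 * (a / (G / 2) + 1) ^ 2 := mul_le_mul_of_nonneg_left (le_self_pow₀ hr1 two_ne_zero) hγ.le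
  · -- hvol from smallness
    rw [(hlett j).2.2.1]
    have hX0 : 0 ≤ 2 * (ϑ * (m * (1 + 2 / kap'') ^ ν)) + (G / 2 + G / 2) := by positivity
    refine vol_of_small hA0 ?_ hX0 ?_ hcE hg ht0.le ht1 hta hnΛ hnN hnZ hcΛ hcN hcΛ0 (le_of_eq (by ring)) hw₂₀
    · -- `8K·A ≤ t`: `A ≤ G∕4` and `G·16K ≤ t`
      have f := mul_le_mul_of_nonneg_right hAG (by linarith only [hnΛ, hnN] : (0 : ℝ) ≤ 8 * (nΛ + nN + 1))
      have e1 : G / 4 * (8 * (nΛ + nN + 1)) = 1 / 8 * (G * (16 * (nΛ + nN + 1))) := by ring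
      linarith only [f, e1, hG16, ht0]
    · -- `X·D ≤ 2t`: `X ≤ 2G` and `G·D = t`
      have hX2G : 2 * (ϑ * (m * (1 + 2 / kap'') ^ ν)) + (G / 2 + G / 2) ≤ 2 * G := by
        have e : 2 * (ϑ * (m * (1 + 2 / kap'') ^ ν)) = 2 * ϑ * (m * (1 + 2 / kap'') ^ ν) := by ring
        linarith only [hθG, e]
      have h := mul_le_mul_of_nonneg_right hX2G hD.le
      have e2 : 2 * G * D = 2 * t := by rw [mul_assoc, hGD]
      rw [hDdef] at h e2
      linarith only [h, e2]


end Summit.QuantumFields.BalabanUV.T4Continuum.Spine.NE5.TwoRunTorusNE5Sizes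

end
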